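import Literature.InformationTheory.Entanglement.WernerStateSeparability
import Literature.LinearAlgebra.Matrix.PosSemidefTrace
import HarnessLib

/-!
# Positivity of `a(𝟙 + Σ cᵢ σᵢ⊗σᵢ)` on separable two-qubit states (Bertlmann–Krammer 2009, Lemma 2;
# Bertlmann–Friis Lemma 17.2)

Hodge foundations lane (`lit-hodgefound`, prover p24 gen 78; quantum-information series).  THEOREMS ONLY: no
definition, no named fact, net debt 0.  Vocabulary of the tree: the one-qubit Pauli matrices `Pauli.X/Y/Z.mat` on
`Bool` (`Computability/QuantumComplexity/PauliExpansion.lean`), `⊗ₖ`, and `IsSeparable` (Bertlmann–Friis Definition 15.5,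
`WernerStateSeparability.lean`); the Hilbert–Schmidt pairing `⟨ρ, C⟩ = Tr ρ C` is `(ρ * C).trace.re`.  The special
case `c = (1,1,1)` (the singlet witness `½𝟙 − |ψ⁻⟩⟨ψ⁻| = ¼(𝟙 + Σσᵢ⊗σᵢ)`) is the tree's
`PPT.isWitness_singletWitness`; this file proves the printed lemma for all `|cᵢ| ≤ 1`.

## Source, VERBATIM — R. A. Bertlmann, P. Krammer, *Entanglement witnesses and geometry of entanglement of two-qutrit
states*, Ann. Phys. 324 (2009) 1388 [BertlmannKrammer2009] §3 (held `paper:arxiv-0901.4729` p0006–p0007); restated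
as Lemma 17.2 of [BertlmannFriis2023] § 17.1.3 (held p0568)

«**Lemma 2.** For any Hermitian operator `C` on a Hilbert space of dimension `2 × 2` that is of the form
`C = a(𝟙 + Σ_{i=1}^3 cᵢ σᵢ ⊗ σᵢ)`, `a ∈ ℝ⁺, cᵢ ∈ ℝ` the expectation value for all separable states is positive,
`⟨ρ, C⟩ ≥ 0 ∀ ρ ∈ S`, if `|cᵢ| ≤ 1 ∀ i`.
Proof. Any separable state `ρ` is a convex combination of product states and thus a separable two–qubit state can be
written as `ρ = Σ_k p_k ¼(𝟙⊗𝟙 + Σ_i nᵢ^k σᵢ⊗𝟙 + Σ_j m_j^k 𝟙⊗σ_j + Σ_{i,j} nᵢ^k m_j^k σᵢ⊗σ_j)`, with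
`nᵢ^k, mᵢ^k ∈ ℝ, |n⃗^k| ≤ 1, |m⃗^k| ≤ 1, p_k ≥ 0, Σ_k p_k = 1` … Performing the trace, we obtain
`⟨ρ, C⟩ = Tr ρ C = Σ_k p_k a(1 + Σ_i cᵢ nᵢ^k mᵢ^k)`, and using the restriction `|cᵢ| ≤ 1 ∀ i` we have
`|Σ_i cᵢ nᵢ^k mᵢ^k| ≤ Σ_i |nᵢ^k||mᵢ^k| ≤ 1`, and since the convex sum of positive terms stays positive we get
`⟨ρ, C⟩ ≥ 0 ∀ ρ ∈ S`. □»

## Proof route (as printed)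

For a product of density matrices `A ⊗ B`: `Tr((A⊗B)C) = a(1 + Σᵢ cᵢ xᵢ yᵢ)` with the Bloch components
`xᵢ = Tr(Aσᵢ)`, `yᵢ = Tr(Bσᵢ)` (real), and `Σ xᵢ² = 2Tr A² − (Tr A)² ≤ 1` (the Bloch ball, from the Pauli expansion
identity and `Tr A² ≤ (Tr A)²`); then `Σ|xᵢ||yᵢ| ≤ ½Σ(xᵢ² + yᵢ²) ≤ 1` gives the product case, and the separable case
follows by linearity of the trace over the tree's `IsSeparable` decomposition.

## What is formalized (all PROVED)

`trace_mul_pauli_im` (Bloch components of a Hermitian matrix are real), `sum_sq_trace_mul_pauli` (the Pauli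
expansion identity `Σᵢ Tr(Aσᵢ)² = 2Tr A² − (Tr A)²`), `bloch_sum_sq_le_one` (`|x⃗| ≤ 1` for a density matrix),
`trace_kronecker_mul_witness` («Performing the trace»), **`BertlmannKrammer_lemma2_kronecker`** (product states) and
**`BertlmannKrammer_lemma2`** (all separable states).

NOT formalized: Lemma 1 (criterion for the nearest separable state) and Lemma 3 (the qutrit analogue with Weyl
operators) of the same paper.  Tree search (FAIL-DUP, 2026-09-01): `rg -n "Lemma 17.2|BertlmannKrammer" Literature` → ∅;
`PPT.isWitness_singletWitness` / `singletWitness_eq_bloch` cover only `c = (1,1,1)`.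
-/

noncomputable section

open Matrix Finset
open scoped ComplexOrder Kronecker

namespace Literature.InformationTheory.Entanglement.BertlmannKrammer

open Literature.Computability.QuantumComplexity (Pauli)
open Literature.InformationTheory.Entanglement.PPT (IsSeparable)
open Literature.LinearAlgebra.Matrix (re_trace_mul_self_le_sq_of_posSemidef)

/-! ## § 1 Bloch components of a qubit density matrix -/

/-- `Tr(A σ_Q)` is real for Hermitian `A`. [cite: BertlmannKrammer2009, §3 Lemma 2 proof («`nᵢ^k, mᵢ^k ∈ ℝ`»)] -/
theorem trace_mul_pauli_im {A : Matrix Bool Bool ℂ} (hA : A.IsHermitian) (Q : Pauli) :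
    ((A * Q.mat).trace).im = 0 := by
  have h : star ((A * Q.mat).trace) = (A * Q.mat).trace := by
    rw [← trace_conjTranspose, conjTranspose_mul, Pauli.conjTranspose_mat, hA.eq, trace_mul_comm]
  have := congrArg Complex.im h
  rw [Complex.star_def, Complex.conj_im] at this
  linarith

/-- **The Pauli expansion identity** for a `2 × 2` matrix: `Σ_{i=1}^3 Tr(Aσᵢ)² = 2 Tr A² − (Tr A)²` (so that
`A = ½(Tr A 𝟙 + Σ xᵢσᵢ)` has `Tr A² = ½((Tr A)² + Σxᵢ²)`). [cite: BertlmannKrammer2009, §3 Lemma 2 proof (the Bloch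
decomposition «`ρ = ¼(𝟙⊗𝟙 + Σ nᵢσᵢ⊗𝟙 + …)`»)] -/
theorem sum_sq_trace_mul_pauli (A : Matrix Bool Bool ℂ) :
    (A * Pauli.X.mat).trace ^ 2 + (A * Pauli.Y.mat).trace ^ 2 + (A * Pauli.Z.mat).trace ^ 2 =
      2 * (A * A).trace - A.trace ^ 2 := by
  simp [Matrix.trace, Matrix.mul_apply]
  linear_combination (A true false - A false true) ^ 2 * Complex.I_sq

/-- **The Bloch ball**: for a qubit density matrix `A` (`A ⪰ 0`, `Tr A = 1`) the Bloch components `xᵢ = Tr(Aσᵢ)`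
satisfy `x₁² + x₂² + x₃² ≤ 1`. [cite: BertlmannKrammer2009, §3 Lemma 2 proof («`|n⃗^k| ≤ 1`»)] -/
theorem bloch_sum_sq_le_one {A : Matrix Bool Bool ℂ} (hA : A.PosSemidef) (hA1 : A.trace = 1) :
    (A * Pauli.X.mat).trace.re ^ 2 + (A * Pauli.Y.mat).trace.re ^ 2 + (A * Pauli.Z.mat).trace.re ^ 2 ≤ 1 := by
  have hid := congrArg Complex.re (sum_sq_trace_mul_pauli A)
  have hX := trace_mul_pauli_im hA.1 Pauli.X
  have hY := trace_mul_pauli_im hA.1 Pauli.Y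
  have hZ := trace_mul_pauli_im hA.1 Pauli.Z
  simp only [Complex.add_re, Complex.sub_re, Complex.mul_re, pow_two, hX, hY, hZ, hA1, Complex.one_re,
    Complex.re_ofNat, Complex.im_ofNat, mul_zero, sub_zero, zero_mul, mul_one] at hid
  have hpur := re_trace_mul_self_le_sq_of_posSemidef hA
  rw [hA1, Complex.one_re, one_pow] at hpur
  nlinarith [hid, hpur]

/-! ## § 2 Lemma 2 -/

/-- «Performing the trace»: for `C = a(𝟙 + Σᵢ cᵢ σᵢ⊗σᵢ)` and a product `A ⊗ B`,
`Tr((A⊗B) C) = a(Tr A Tr B + Σᵢ cᵢ Tr(Aσᵢ) Tr(Bσᵢ))`. [cite: BertlmannKrammer2009, §3 Lemma 2 proof] -/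
theorem trace_kronecker_mul_witness (A B : Matrix Bool Bool ℂ) (a c₁ c₂ c₃ : ℂ) :
    ((A ⊗ₖ B) * (a • ((1 : Matrix (Bool × Bool) (Bool × Bool) ℂ) + c₁ • (Pauli.X.mat ⊗ₖ Pauli.X.mat) +
        c₂ • (Pauli.Y.mat ⊗ₖ Pauli.Y.mat) + c₃ • (Pauli.Z.mat ⊗ₖ Pauli.Z.mat)))).trace =
      a * (A.trace * B.trace + c₁ * ((A * Pauli.X.mat).trace * (B * Pauli.X.mat).trace) +
        c₂ * ((A * Pauli.Y.mat).trace * (B * Pauli.Y.mat).trace) +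
        c₃ * ((A * Pauli.Z.mat).trace * (B * Pauli.Z.mat).trace)) := by
  rw [Matrix.mul_smul, trace_smul, smul_eq_mul, Matrix.mul_add, Matrix.mul_add, Matrix.mul_add, Matrix.mul_one,
    Matrix.mul_smul, Matrix.mul_smul, Matrix.mul_smul, ← mul_kronecker_mul, ← mul_kronecker_mul, ← mul_kronecker_mul,
    trace_add, trace_add, trace_add, trace_smul, trace_smul, trace_smul, trace_kronecker, trace_kronecker,
    trace_kronecker, trace_kronecker, smul_eq_mul, smul_eq_mul, smul_eq_mul]

/-- **Lemma 2 for product states**: `Tr((A⊗B) C) ≥ 0` for density matrices `A, B` and `C = a(𝟙 + Σᵢ cᵢ σᵢ⊗σᵢ)` with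
`a > 0`, `|cᵢ| ≤ 1` — «`|Σᵢ cᵢ nᵢ mᵢ| ≤ Σᵢ |nᵢ||mᵢ| ≤ 1`». [cite: BertlmannKrammer2009, §3 Lemma 2]
[cite: BertlmannFriis2023, §17.1.3 Lemma 17.2] -/
theorem BertlmannKrammer_lemma2_kronecker {a c₁ c₂ c₃ : ℝ} (ha : 0 < a) (h₁ : |c₁| ≤ 1) (h₂ : |c₂| ≤ 1)
    (h₃ : |c₃| ≤ 1) {A B : Matrix Bool Bool ℂ} (hA : A.PosSemidef) (hA1 : A.trace = 1) (hB : B.PosSemidef)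
    (hB1 : B.trace = 1) :
    0 ≤ (((A ⊗ₖ B) * ((a : ℂ) • ((1 : Matrix (Bool × Bool) (Bool × Bool) ℂ) +
        (c₁ : ℂ) • (Pauli.X.mat ⊗ₖ Pauli.X.mat) + (c₂ : ℂ) • (Pauli.Y.mat ⊗ₖ Pauli.Y.mat) +
        (c₃ : ℂ) • (Pauli.Z.mat ⊗ₖ Pauli.Z.mat)))).trace).re := by
  rw [trace_kronecker_mul_witness, hA1, hB1]
  -- real Bloch components
  have hXA := trace_mul_pauli_im hA.1 Pauli.X
  have hYA := trace_mul_pauli_im hA.1 Pauli.Y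
  have hZA := trace_mul_pauli_im hA.1 Pauli.Z
  have hXB := trace_mul_pauli_im hB.1 Pauli.X
  have hYB := trace_mul_pauli_im hB.1 Pauli.Y
  have hZB := trace_mul_pauli_im hB.1 Pauli.Z
  simp only [Complex.mul_re, Complex.add_re, Complex.ofReal_re, Complex.ofReal_im, Complex.mul_im, Complex.add_im,
    Complex.one_re, Complex.one_im, hXA, hYA, hZA, hXB, hYB, hZB, mul_zero, zero_mul, sub_zero, add_zero, mul_one]
  set x₁ := (A * Pauli.X.mat).trace.re
  set x₂ := (A * Pauli.Y.mat).trace.re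
  set x₃ := (A * Pauli.Z.mat).trace.re
  set y₁ := (B * Pauli.X.mat).trace.re
  set y₂ := (B * Pauli.Y.mat).trace.re
  set y₃ := (B * Pauli.Z.mat).trace.re
  have hx := bloch_sum_sq_le_one hA hA1
  have hy := bloch_sum_sq_le_one hB hB1
  -- `cᵢ xᵢ yᵢ ≥ −|xᵢ yᵢ| ≥ −(xᵢ² + yᵢ²)/2`
  have key : ∀ (c x y : ℝ), |c| ≤ 1 → -((x ^ 2 + y ^ 2) / 2) ≤ c * (x * y) := by
    intro c x y hc
    have h1 : |c * (x * y)| ≤ |x * y| := by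
      rw [abs_mul]; exact mul_le_of_le_one_left (abs_nonneg _) hc
    have h2 : |x * y| ≤ (x ^ 2 + y ^ 2) / 2 := by
      rw [abs_mul, ← sq_abs x, ← sq_abs y]; nlinarith [two_mul_le_add_sq |x| |y|, abs_nonneg x, abs_nonneg y]
    have h3 := neg_abs_le (c * (x * y))
    linarith
  have k₁ := key c₁ x₁ y₁ h₁
  have k₂ := key c₂ x₂ y₂ h₂
  have k₃ := key c₃ x₃ y₃ h₃
  have hsum : 0 ≤ 1 + c₁ * (x₁ * y₁) + c₂ * (x₂ * y₂) + c₃ * (x₃ * y₃) := by nlinarith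
  exact mul_nonneg ha.le hsum

/-- **Lemma 2 (Bertlmann–Krammer 2009; Bertlmann–Friis Lemma 17.2)**: for `a > 0` and real `c₁, c₂, c₃` with
`|cᵢ| ≤ 1`, the operator `C = a(𝟙 + Σ_{i=1}^3 cᵢ σᵢ⊗σᵢ)` has non-negative expectation value `⟨ρ, C⟩ = Tr(ρC) ≥ 0` on
every separable two-qubit state `ρ`. [cite: BertlmannKrammer2009, §3 Lemma 2] [cite: BertlmannFriis2023, §17.1.3
Lemma 17.2] -/
theorem BertlmannKrammer_lemma2 {a c₁ c₂ c₃ : ℝ} (ha : 0 < a) (h₁ : |c₁| ≤ 1) (h₂ : |c₂| ≤ 1) (h₃ : |c₃| ≤ 1)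
    {ρ : Matrix (Bool × Bool) (Bool × Bool) ℂ} (hρ : IsSeparable ρ) :
    0 ≤ ((ρ * ((a : ℂ) • ((1 : Matrix (Bool × Bool) (Bool × Bool) ℂ) +
        (c₁ : ℂ) • (Pauli.X.mat ⊗ₖ Pauli.X.mat) + (c₂ : ℂ) • (Pauli.Y.mat ⊗ₖ Pauli.Y.mat) +
        (c₃ : ℂ) • (Pauli.Z.mat ⊗ₖ Pauli.Z.mat)))).trace).re := by
  obtain ⟨T, hT, p, σA, σB, hp, -, hσA, hσB, rfl⟩ := hρ
  rw [Finset.sum_mul, trace_sum, Complex.re_sum]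
  refine Finset.sum_nonneg fun t _ => ?_
  rw [Matrix.smul_mul, trace_smul, smul_eq_mul, Complex.re_ofReal_mul]
  exact mul_nonneg (hp t)
    (BertlmannKrammer_lemma2_kronecker ha h₁ h₂ h₃ (hσA t).1 (hσA t).2 (hσB t).1 (hσB t).2)

end Literature.InformationTheory.Entanglement.BertlmannKrammer
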